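import Summits.BirchSwinnertonDyer.Rank1Residual.P2.CongruentNumberPairsAtTwoDoorAAtlasThreeCensus
import Summits.BirchSwinnertonDyer.Rank1Residual.P2.GenusSumsThreePrimes
import HarnessLib

/-!
# Sub-lane «bsd-p2»: the EVEN `ω(m) = 3` ATLAS, file 1/2 — Monsky's EVEN matrix, the Rédei bit of an
# even block and `Σ₂′(2p₀p₁p₂)` READ ON A LEGENDRE CONFIGURATION; the finite census «kernel `2` ⟹
# (`Σ₂′` even ⟺ one of the THIRTEEN registered silent keys)»

HONEST FRAMING (sub-lane «bsd-p2», run/shared/lean/b2b/bsd-rank1-residual/p2/, verbatim in every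
file): the target of record is the FULL Birch–Swinnerton-Dyer formula for EVERY analytic-rank `≤ 1`
`E/ℚ` at ALL primes INCLUDING `2`; the odd-prime class ledger is referee A's; the `2`-part is OPEN
(cells O1 = X5 ∖ CM and O12 = the CM corner) and under census by «bsd-p2». Census / instrument
output at `2` = EVIDENCE / conjecture items with held-out validation, NEVER a Literature fact;
certificates close PAIRS (one isogeny class, `p = 2`), never classes. This file asserts NO
arithmetic fact; it contains only COMPUTABLE DEFINITIONS (matrices over `𝔽₂` and `Bool` predicates
read on a configuration, in the style of `CongruentNumberPairsAtTwoDoorAAtlasThreeCensus.lean`) and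
finite statements decided by `decide`; nothing here mentions a prime.

WHAT IT DOES. The even twin of ATLAS-A3. For `n = 2·p₀p₁p₂ ≡ 6 (mod 8)` (`p₀p₁p₂ ≡ 3 (mod 4)`) the two
inputs of DOOR B6 (`rankOne_sha_bsdp_two_congruentNumberCurve_of_genusPointData_six`: Monsky kernel `2`
and `Σ₂′(n)` odd ⟹ `r_an = 1`, rank `1`, `Ш[2^∞] = 0`, `BSD(E_n, 2)`) are functions of the LEGENDRE
CONFIGURATION `(rᵢ = pᵢ mod 8, β a b = [(p_b/p_a) = −1])`. §1 reads them: `monskyCfgEven` = Monsky's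
EVEN matrix `(Aᵀ + D₂, D₋₁; D₂, A + D₂)`; `redeiCfgTwo` / `gBitCfgTwo` = Li–Ma's Rédei matrix of
`ℚ(√−2m)` (`D = −8m`: the row of the prime `2` reads `[(D₂/p_a) = −1]` with `D₂ = 8` for `m ≡ 3`, `−8`
for `m ≡ 1 (mod 4)`, the column `[(p_b^*/2) = −1] = [p_b ≡ ±3 (8)]`) and its kernel bit `g(2m) mod 2`;
`pat₄` = TYZ's printed `Σ₂` residue pattern on four blocks; `sigma2'CfgEven` = the fifteen-term reading of `Σ₂′(2p₀p₁p₂)` (the shape of `natCast_genusSum₂'_four` at `q = 2`, typer GEN 23 `GenusSumsFourPrimes`);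
`silentEvenKey` = the THIRTEEN silent family keys REGISTERED for PR-P2-5 / PR-P2-6 (STRUCTURE-p2 §7,
census-3 `FEASIBILITY-PT16A.md` §3; residue triple ascending, upper bits `(β₀₁, β₀₂, β₁₂)`), VERBATIM;
`silentEvenCfg` = «some relabelling of the triple is a registered key». §2 is the FINITE CENSUS over the
`256` ordered configurations with `r₀r₁r₂ ≡ 3 (mod 4)` (typer desk `p2/typer/cn/even_l3_atlas.py`:
kernel `2` on `194` = `128` LOUD (`Σ₂′` odd) + `66` SILENT; kernel `≥ 8` on `62`), one `decide` per
leading residue and class of `r₀r₁r₂ mod 8`: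
* `evenSigmaCfg_iff_of_card_ker` — given Monsky kernel `2`, `Σ₂′ ≡ 0 (mod 2)` iff `silentEvenCfg`;
* `card_ker_of_silentEvenCfg` — every registered key has Monsky kernel `2` (`s(n) = 1`).
So «`s(n) = 1` and TYZ Thm 1.2 / DOOR B6 SILENT» ⟺ «one of the 13 keys» is a KERNEL statement on
configurations (third derivation of idea-2 T16.2 / census-3's `52/52` cross-read, the first symbolic one).
That the REAL Monsky matrix / genus sums of `2p₀p₁p₂` equal these readings, and the door corollaries,
are file 2/2. Nothing booked; no mark moved; the even `ℓ = 3` regime is PT16A / PT16B's SCORED one — no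
`ℓ = 4` object occurs. Unit `b2b-bsdres-p2-typer` GEN 23; scratch (NOT proposed — rails T-149 (e) /
T-155 (o)).

References: [HeathBrown1994SelmerCongruentII] Appendix (Monsky), typescript p. 41 L20–L36 (even `D`);
[TianYuanZhang2017] Thm 1.2 (the second genus sum for `n ≡ 6 (mod 8)`), §1; [LiMa2008] Lemma 0.1,
Def 0.2, Thm 0.4; [Cox2013] §5.B (`(D/2)`); [IrelandRosen1990] Ch. 5 §1 Prop. 5.1.2–5.1.3, §2 Thm 1;
HOME/p2/STRUCTURE-p2.md §7 (the 13 silent families); HOME/p2/census-3/spec/FEASIBILITY-PT16A.md §3.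
-/

open Matrix Finset

set_option autoImplicit false

namespace Summit.BirchSwinnertonDyer.Rank1Residual.P2

/-! ## §1 The even-side readings on a configuration (computable) -/

section Config

variable {t : ℕ}

/-- TYZ's residue pattern for a four-block decomposition `{w, x, y, z}`: some ordered pair of distinct
blocks is `(≡ 5,6,7 ; ≡ 1,2,3)` and the two remaining blocks are `≡ 1 (mod 8)` (a `Bool`).
[cite: TianYuanZhang2017, Thm. 1.2 (Σ₂: d₀ ≡ 5,6,7, d₁ ≡ 1,2,3, dᵢ ≡ 1 (mod 8) for i > 1)] -/
def pat₄ (w x y z : ℕ) : Bool :=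
  (pat₂ w x && y % 8 == 1 && z % 8 == 1) || (pat₂ w y && x % 8 == 1 && z % 8 == 1) ||
  (pat₂ w z && x % 8 == 1 && y % 8 == 1) || (pat₂ x y && w % 8 == 1 && z % 8 == 1) ||
  (pat₂ x z && w % 8 == 1 && y % 8 == 1) || (pat₂ y z && w % 8 == 1 && x % 8 == 1)

/-- `pat₄` only depends on residues mod `8`. [cite: TianYuanZhang2017, Thm. 1.2 (Σ₂)] -/
theorem pat₄_mod (w x y z : ℕ) : pat₄ (w % 8) (x % 8) (y % 8) (z % 8) = pat₄ w x y z := by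
  unfold pat₄; simp only [pat₂_mod, Nat.mod_mod]

/-- The printed pattern predicate `pat₄`, unfolded. [cite: TianYuanZhang2017, Thm. 1.2 (Σ₂)] -/
theorem pat₄_iff (w x y z : ℕ) : pat₄ w x y z = true ↔
    ((pat₂ w x = true ∧ y % 8 = 1 ∧ z % 8 = 1) ∨ (pat₂ w y = true ∧ x % 8 = 1 ∧ z % 8 = 1) ∨
     (pat₂ w z = true ∧ x % 8 = 1 ∧ y % 8 = 1) ∨ (pat₂ x y = true ∧ w % 8 = 1 ∧ z % 8 = 1) ∨
     (pat₂ x z = true ∧ w % 8 = 1 ∧ y % 8 = 1) ∨ (pat₂ y z = true ∧ w % 8 = 1 ∧ x % 8 = 1)) := by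
  unfold pat₄
  simp only [Bool.or_eq_true, Bool.and_eq_true, beq_iff_eq, or_assoc, and_assoc]


/-- **Monsky's matrix for EVEN `n = 2p₁⋯p_t` read on a configuration** (`rᵢ = pᵢ mod 8`):
`M = (Aᵀ + D₂, D₋₁; D₂, A + D₂)` with `A = legendreCfg β`, `D₂ = diag χ₈(rᵢ)` (`[(2/p) = −1]`),
`D₋₁ = diag χ₄(rᵢ)` (`[(−1/p) = −1] = [p ≡ 3 (4)]`).
[cite: HeathBrown1994SelmerCongruentII, Appendix (Monsky), typescript p. 41 L20–L36]
[cite: IrelandRosen1990, Ch. 5 §1 Prop. 5.1.2–5.1.3] -/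
def monskyCfgEven (r : Fin t → ℕ) (β : Fin t → Fin t → ZMod 2) :
    Matrix (Fin t ⊕ Fin t) (Fin t ⊕ Fin t) (ZMod 2) :=
  Matrix.fromBlocks ((legendreCfg β)ᵀ + Matrix.diagonal fun i => chi8Bit (r i))
    (Matrix.diagonal fun i => chi4Bit (r i)) (Matrix.diagonal fun i => chi8Bit (r i))
    (legendreCfg β + Matrix.diagonal fun i => chi8Bit (r i))

/-- Entries of Li–Ma's Rédei matrix `RM(−8m)` of `ℚ(√−2m)`, `m = ∏ pᵢ` odd, on a configuration (index
`none ↦` the prime `2`, prime discriminant `D₂ = 8` if `m ≡ 3`, `−8` if `m ≡ 1 (mod 4)`): odd–odd entries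
as in `redeiEntryCfg`; `[(D₂/p_a) = −1] = [(±2/p_a) = −1] = χ₈(r_a) + [m ≡ 1 (4)]·χ₄(r_a)`;
`[(D_b/2) = −1] = [D_b ≡ 5 (8)] = [p_b ≡ ±3 (8)]`.
[cite: LiMa2008, Lemma 0.1 and Def. 0.2 (p. 279)] [cite: Cox2013, §5.B ((D/2))]
[cite: IrelandRosen1990, Ch. 5 §1 Prop. 5.1.2–5.1.3 ((−1/p), (2/p))] -/
def redeiEntryCfgTwo (r : Fin t → ℕ) (β : Fin t → Fin t → ZMod 2) :
    Option (Fin t) → Option (Fin t) → ZMod 2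
  | some a, some b => redeiEntryCfg r β a b
  | some a, none => chi8Bit (r a) + if (∏ i, r i) % 4 = 1 then chi4Bit (r a) else 0
  | none, some b => chi8Bit (r b)
  | none, none => 0

/-- Rédei matrix `RM(−8m)` of `ℚ(√−2m)` on a configuration (`m = ∏ pᵢ` odd; `t = 0` is `ℚ(√−2)`).
[cite: LiMa2008, Def. 0.2 (p. 279)] -/
def redeiCfgTwo (r : Fin t → ℕ) (β : Fin t → Fin t → ZMod 2) :
    Matrix (Option (Fin t)) (Option (Fin t)) (ZMod 2) :=
  Matrix.of fun a b => if a = b then ∑ c ∈ univ.erase a, redeiEntryCfgTwo r β a c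
    else redeiEntryCfgTwo r β a b

/-- `g(2m) mod 2` on a configuration (`m = ∏ pᵢ`): the Rédei kernel of `RM(−8m)` has `2` elements iff
`g(2m) = #2Cl(ℚ(√−2m))` is odd (Rédei–Reichardt). [cite: LiMa2008, Thm. 0.4 (p. 280)] [cite: TianYuanZhang2017, §1 (p0002 L78–L86)] -/
def gBitCfgTwo (r : Fin t → ℕ) (β : Fin t → Fin t → ZMod 2) : ZMod 2 :=
  if Fintype.card {v : Option (Fin t) → ZMod 2 // redeiCfgTwo r β *ᵥ v = 0} = 2 then 1 else 0

/-- `g(2·d_T) mod 2` for the even block `2·∏_{i ∈ T} pᵢ` of `n = 2p₀p₁p₂`, `T` given by an embedding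
`e : Fin m → Fin 3` (the sub-configuration; `m = 0` is the block `2`). [cite: TianYuanZhang2017, §1 (p0002 L78–L86)] -/
def gBitTwoSub {m : ℕ} (e : Fin m → Fin 3) (r : Fin 3 → ℕ) (β : Fin 3 → Fin 3 → ZMod 2) : ZMod 2 :=
  gBitCfgTwo (fun i => r (e i)) (fun a b => β (e a) (e b))

/-- **`Σ₂′(2p₀p₁p₂) mod 2` on a configuration**: TYZ's PRINTED second sum over the fifteen decompositions
of `{2, p₀, p₁, p₂}` — the one-block term `g(n)` (counted: `n ≡ 6 (mod 8)`), seven two-block, six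
three-block and one four-block term, each the printed residue pattern (`pat₂ / pat₃ / pat₄`) times the
product of the `g`-bits of its blocks (`gBitSub` for odd blocks, `gBitTwoSub` for the even one); term by
term the reading of `natCast_genusSum₂'_four` at `q = 2`. [cite: TianYuanZhang2017, Thm. 1.2 (Σ₂ for n ≡ 6 (mod 8)) and proof of Prop. 3.4 (p0016 L146)] -/
def sigma2'CfgEven (r : Fin 3 → ℕ) (β : Fin 3 → Fin 3 → ZMod 2) : ZMod 2 :=
  gBitTwoSub ![0, 1, 2] r β
  + bitOf (pat₂ 2 (r 0 * r 1 * r 2) = true) * (gBitTwoSub (![] : Fin 0 → Fin 3) r β * gBitSub ![0, 1, 2] r β)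
  + bitOf (pat₂ (2 * r 0) (r 1 * r 2) = true) * (gBitTwoSub ![0] r β * gBitSub ![1, 2] r β)
  + bitOf (pat₂ (2 * r 1) (r 0 * r 2) = true) * (gBitTwoSub ![1] r β * gBitSub ![0, 2] r β)
  + bitOf (pat₂ (2 * r 2) (r 0 * r 1) = true) * (gBitTwoSub ![2] r β * gBitSub ![0, 1] r β)
  + bitOf (pat₂ (2 * r 1 * r 2) (r 0) = true) * (gBitTwoSub ![1, 2] r β * gBitSub ![0] r β)
  + bitOf (pat₂ (2 * r 0 * r 2) (r 1) = true) * (gBitTwoSub ![0, 2] r β * gBitSub ![1] r β)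
  + bitOf (pat₂ (2 * r 0 * r 1) (r 2) = true) * (gBitTwoSub ![0, 1] r β * gBitSub ![2] r β)
  + bitOf (pat₃ 2 (r 0) (r 1 * r 2) = true) *
      (gBitTwoSub (![] : Fin 0 → Fin 3) r β * gBitSub ![0] r β * gBitSub ![1, 2] r β)
  + bitOf (pat₃ 2 (r 1) (r 0 * r 2) = true) *
      (gBitTwoSub (![] : Fin 0 → Fin 3) r β * gBitSub ![1] r β * gBitSub ![0, 2] r β)
  + bitOf (pat₃ 2 (r 2) (r 0 * r 1) = true) *
      (gBitTwoSub (![] : Fin 0 → Fin 3) r β * gBitSub ![2] r β * gBitSub ![0, 1] r β)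
  + bitOf (pat₃ (2 * r 0) (r 1) (r 2) = true) * (gBitTwoSub ![0] r β * gBitSub ![1] r β * gBitSub ![2] r β)
  + bitOf (pat₃ (2 * r 1) (r 0) (r 2) = true) * (gBitTwoSub ![1] r β * gBitSub ![0] r β * gBitSub ![2] r β)
  + bitOf (pat₃ (2 * r 2) (r 0) (r 1) = true) * (gBitTwoSub ![2] r β * gBitSub ![0] r β * gBitSub ![1] r β)
  + bitOf (pat₄ 2 (r 0) (r 1) (r 2) = true) *
      (gBitTwoSub (![] : Fin 0 → Fin 3) r β * gBitSub ![0] r β * gBitSub ![1] r β * gBitSub ![2] r β)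

/-- **The THIRTEEN REGISTERED SILENT KEYS, verbatim** (residue triple ascending; upper bits
`(β₀₁, β₀₂, β₁₂)`, `β a b = [(p_b/p_a) = −1]` — census-3's `canon_key` convention): the even `ℓ = 3`
families on which `s(n) = 1` and `Σ₂′(n)` is even (TYZ Thm 1.2 / DOOR B6 silent), as listed in
STRUCTURE-p2 §7 / `FEASIBILITY-PT16A.md` §3 (family minima `870, 910, 966, 1230, 1302, 1518, 1590, 1830,
2030, 2190, 2870, 4270, 7910`). A `Bool` read on an ordered configuration. IN WORDS, by residue type
(Legendre symbols; each clause verified against this table on all `256` configurations by the desk script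
`p2/typer/cn/even_l3_atlas.py`; no silent key on the types `{1,1,3}`, `{1,1,7}`, `{3,3,3}`, `{7,7,7}`):
`{1,3,5}` (`u ≡ 1, q ≡ 3, p ≡ 5`): `(p/q) = −1 ∧ (u/q)(u/p) = −1`; `{1,5,7}` (`u ≡ 1, p ≡ 5, w ≡ 7`):
`(w/p) = −1 ∧ (u/p)(u/w) = −1`; `{3,3,7}` (`q, q′ ≡ 3, w ≡ 7`): `(w/q)(w/q′) = −1 ∧ (q′/q) = (w/q)`;
`{3,5,5}` (`q ≡ 3; p, p′ ≡ 5`): `(p/q) = (p′/q) = −1`, or `(p/q)(p′/q) = −1 ∧ (p′/p) = +1`; `{3,7,7}`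
(`q ≡ 3; w, w′ ≡ 7`): `(w/q) = (w′/q) = +1`, or `(w/q) = +1 ∧ (w′/q) = −1 ∧ (w′/w) = +1`; `{5,5,7}`
(`p, p′ ≡ 5, w ≡ 7`): `(p′/p) = +1 ∧ ¬((w/p) = (w/p′) = +1)`, or `(p′/p) = −1 ∧ (w/p) = (w/p′) = −1`.
[cite: TianYuanZhang2017, Thm. 1.2 (n ≡ 6 (mod 8): the second sum)] -/
def silentEvenKey (r : Fin 3 → ℕ) (β : Fin 3 → Fin 3 → ZMod 2) : Bool :=
  decide (((r 0 % 8, r 1 % 8, r 2 % 8), (β 0 1, β 0 2, β 1 2)) ∈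
    ([((1, 3, 5), (0, 1, 1)), ((1, 3, 5), (1, 0, 1)), ((1, 5, 7), (0, 1, 1)), ((1, 5, 7), (1, 0, 1)),
      ((3, 3, 7), (0, 0, 1)), ((3, 5, 5), (0, 1, 0)), ((3, 5, 5), (1, 1, 0)), ((3, 5, 5), (1, 1, 1)),
      ((3, 7, 7), (0, 0, 0)), ((3, 7, 7), (0, 1, 0)), ((5, 5, 7), (0, 0, 1)), ((5, 5, 7), (0, 1, 1)),
      ((5, 5, 7), (1, 1, 1))] : List ((ℕ × ℕ × ℕ) × (ZMod 2 × ZMod 2 × ZMod 2))))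

/-- **SILENT configuration** (even `ω(m) = 3`): some relabelling of the prime triple is a registered
silent key (the six permutations of `Fin 3`, listed). [cite: TianYuanZhang2017, Thm. 1.2 (n ≡ 6 (mod 8))] -/
def silentEvenCfg (r : Fin 3 → ℕ) (β : Fin 3 → Fin 3 → ZMod 2) : Bool :=
  [(![0, 1, 2] : Fin 3 → Fin 3), ![0, 2, 1], ![1, 0, 2], ![1, 2, 0], ![2, 0, 1], ![2, 1, 0]].any
    fun σ => silentEvenKey (fun i => r (σ i)) (fun a b => β (σ a) (σ b))

end Config

/-! ## §2 The finite census (configurations = residues `rᵢ : Fin 8` with `r₀r₁r₂ ≡ 3 (mod 4)`, upper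
symbol bits `s₀ = β 0 1`, `s₁ = β 0 2`, `s₂ = β 1 2`, the lower ones by reciprocity through `betaOf`; one
`decide` per leading residue `r₀` and class of `r₀r₁r₂ mod 8` — even residues are vacuous) -/

section Census

/-- `r₀ ≡ 1`, `r₀r₁r₂ ≡ 3 (mod 8)`: given Monsky kernel `2`, `Σ₂′ ≡ 0` iff silent (`32` configurations). `decide`.
[cite: TianYuanZhang2017, Thm. 1.2] [cite: HeathBrown1994SelmerCongruentII, Appendix (Monsky), typescript p. 41 L20–L36] -/
theorem evenSigmaCfg_iff_of_card_ker_one_three : ∀ (r₁ r₂ : Fin 8) (s₀ s₁ s₂ : ZMod 2),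
    (1 * r₁.val * r₂.val) % 8 = 3 →
    Fintype.card {v : Fin 3 ⊕ Fin 3 → ZMod 2 //
      monskyCfgEven ![1, r₁.val, r₂.val] (betaOf ![1, r₁.val, r₂.val] ![s₀, s₁, s₂]) *ᵥ v = 0} = 2 →
    (sigma2'CfgEven ![1, r₁.val, r₂.val] (betaOf ![1, r₁.val, r₂.val] ![s₀, s₁, s₂]) = 0 ↔
      silentEvenCfg ![1, r₁.val, r₂.val] (betaOf ![1, r₁.val, r₂.val] ![s₀, s₁, s₂]) = true) := by
  decide

/-- `r₀ ≡ 1`, `r₀r₁r₂ ≡ 7 (mod 8)`: given Monsky kernel `2`, `Σ₂′ ≡ 0` iff silent (`32` configurations). `decide`.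
[cite: TianYuanZhang2017, Thm. 1.2] [cite: HeathBrown1994SelmerCongruentII, Appendix (Monsky), typescript p. 41 L20–L36] -/
theorem evenSigmaCfg_iff_of_card_ker_one_seven : ∀ (r₁ r₂ : Fin 8) (s₀ s₁ s₂ : ZMod 2),
    (1 * r₁.val * r₂.val) % 8 = 7 →
    Fintype.card {v : Fin 3 ⊕ Fin 3 → ZMod 2 //
      monskyCfgEven ![1, r₁.val, r₂.val] (betaOf ![1, r₁.val, r₂.val] ![s₀, s₁, s₂]) *ᵥ v = 0} = 2 →
    (sigma2'CfgEven ![1, r₁.val, r₂.val] (betaOf ![1, r₁.val, r₂.val] ![s₀, s₁, s₂]) = 0 ↔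
      silentEvenCfg ![1, r₁.val, r₂.val] (betaOf ![1, r₁.val, r₂.val] ![s₀, s₁, s₂]) = true) := by
  decide

/-- `r₀ ≡ 3`, `r₀r₁r₂ ≡ 3 (mod 8)`: given Monsky kernel `2`, `Σ₂′ ≡ 0` iff silent (`32` configurations). `decide`.
[cite: TianYuanZhang2017, Thm. 1.2] [cite: HeathBrown1994SelmerCongruentII, Appendix (Monsky), typescript p. 41 L20–L36] -/
theorem evenSigmaCfg_iff_of_card_ker_three_three : ∀ (r₁ r₂ : Fin 8) (s₀ s₁ s₂ : ZMod 2),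
    (3 * r₁.val * r₂.val) % 8 = 3 →
    Fintype.card {v : Fin 3 ⊕ Fin 3 → ZMod 2 //
      monskyCfgEven ![3, r₁.val, r₂.val] (betaOf ![3, r₁.val, r₂.val] ![s₀, s₁, s₂]) *ᵥ v = 0} = 2 →
    (sigma2'CfgEven ![3, r₁.val, r₂.val] (betaOf ![3, r₁.val, r₂.val] ![s₀, s₁, s₂]) = 0 ↔
      silentEvenCfg ![3, r₁.val, r₂.val] (betaOf ![3, r₁.val, r₂.val] ![s₀, s₁, s₂]) = true) := by
  decide

/-- `r₀ ≡ 3`, `r₀r₁r₂ ≡ 7 (mod 8)`: given Monsky kernel `2`, `Σ₂′ ≡ 0` iff silent (`32` configurations). `decide`.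
[cite: TianYuanZhang2017, Thm. 1.2] [cite: HeathBrown1994SelmerCongruentII, Appendix (Monsky), typescript p. 41 L20–L36] -/
theorem evenSigmaCfg_iff_of_card_ker_three_seven : ∀ (r₁ r₂ : Fin 8) (s₀ s₁ s₂ : ZMod 2),
    (3 * r₁.val * r₂.val) % 8 = 7 →
    Fintype.card {v : Fin 3 ⊕ Fin 3 → ZMod 2 //
      monskyCfgEven ![3, r₁.val, r₂.val] (betaOf ![3, r₁.val, r₂.val] ![s₀, s₁, s₂]) *ᵥ v = 0} = 2 →
    (sigma2'CfgEven ![3, r₁.val, r₂.val] (betaOf ![3, r₁.val, r₂.val] ![s₀, s₁, s₂]) = 0 ↔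
      silentEvenCfg ![3, r₁.val, r₂.val] (betaOf ![3, r₁.val, r₂.val] ![s₀, s₁, s₂]) = true) := by
  decide

/-- `r₀ ≡ 5`, `r₀r₁r₂ ≡ 3 (mod 8)`: given Monsky kernel `2`, `Σ₂′ ≡ 0` iff silent (`32` configurations). `decide`.
[cite: TianYuanZhang2017, Thm. 1.2] [cite: HeathBrown1994SelmerCongruentII, Appendix (Monsky), typescript p. 41 L20–L36] -/
theorem evenSigmaCfg_iff_of_card_ker_five_three : ∀ (r₁ r₂ : Fin 8) (s₀ s₁ s₂ : ZMod 2),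
    (5 * r₁.val * r₂.val) % 8 = 3 →
    Fintype.card {v : Fin 3 ⊕ Fin 3 → ZMod 2 //
      monskyCfgEven ![5, r₁.val, r₂.val] (betaOf ![5, r₁.val, r₂.val] ![s₀, s₁, s₂]) *ᵥ v = 0} = 2 →
    (sigma2'CfgEven ![5, r₁.val, r₂.val] (betaOf ![5, r₁.val, r₂.val] ![s₀, s₁, s₂]) = 0 ↔
      silentEvenCfg ![5, r₁.val, r₂.val] (betaOf ![5, r₁.val, r₂.val] ![s₀, s₁, s₂]) = true) := by
  decide

/-- `r₀ ≡ 5`, `r₀r₁r₂ ≡ 7 (mod 8)`: given Monsky kernel `2`, `Σ₂′ ≡ 0` iff silent (`32` configurations). `decide`.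
[cite: TianYuanZhang2017, Thm. 1.2] [cite: HeathBrown1994SelmerCongruentII, Appendix (Monsky), typescript p. 41 L20–L36] -/
theorem evenSigmaCfg_iff_of_card_ker_five_seven : ∀ (r₁ r₂ : Fin 8) (s₀ s₁ s₂ : ZMod 2),
    (5 * r₁.val * r₂.val) % 8 = 7 →
    Fintype.card {v : Fin 3 ⊕ Fin 3 → ZMod 2 //
      monskyCfgEven ![5, r₁.val, r₂.val] (betaOf ![5, r₁.val, r₂.val] ![s₀, s₁, s₂]) *ᵥ v = 0} = 2 →
    (sigma2'CfgEven ![5, r₁.val, r₂.val] (betaOf ![5, r₁.val, r₂.val] ![s₀, s₁, s₂]) = 0 ↔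
      silentEvenCfg ![5, r₁.val, r₂.val] (betaOf ![5, r₁.val, r₂.val] ![s₀, s₁, s₂]) = true) := by
  decide

/-- `r₀ ≡ 7`, `r₀r₁r₂ ≡ 3 (mod 8)`: given Monsky kernel `2`, `Σ₂′ ≡ 0` iff silent (`32` configurations). `decide`.
[cite: TianYuanZhang2017, Thm. 1.2] [cite: HeathBrown1994SelmerCongruentII, Appendix (Monsky), typescript p. 41 L20–L36] -/
theorem evenSigmaCfg_iff_of_card_ker_seven_three : ∀ (r₁ r₂ : Fin 8) (s₀ s₁ s₂ : ZMod 2),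
    (7 * r₁.val * r₂.val) % 8 = 3 →
    Fintype.card {v : Fin 3 ⊕ Fin 3 → ZMod 2 //
      monskyCfgEven ![7, r₁.val, r₂.val] (betaOf ![7, r₁.val, r₂.val] ![s₀, s₁, s₂]) *ᵥ v = 0} = 2 →
    (sigma2'CfgEven ![7, r₁.val, r₂.val] (betaOf ![7, r₁.val, r₂.val] ![s₀, s₁, s₂]) = 0 ↔
      silentEvenCfg ![7, r₁.val, r₂.val] (betaOf ![7, r₁.val, r₂.val] ![s₀, s₁, s₂]) = true) := by
  decide

/-- `r₀ ≡ 7`, `r₀r₁r₂ ≡ 7 (mod 8)`: given Monsky kernel `2`, `Σ₂′ ≡ 0` iff silent (`32` configurations). `decide`.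
[cite: TianYuanZhang2017, Thm. 1.2] [cite: HeathBrown1994SelmerCongruentII, Appendix (Monsky), typescript p. 41 L20–L36] -/
theorem evenSigmaCfg_iff_of_card_ker_seven_seven : ∀ (r₁ r₂ : Fin 8) (s₀ s₁ s₂ : ZMod 2),
    (7 * r₁.val * r₂.val) % 8 = 7 →
    Fintype.card {v : Fin 3 ⊕ Fin 3 → ZMod 2 //
      monskyCfgEven ![7, r₁.val, r₂.val] (betaOf ![7, r₁.val, r₂.val] ![s₀, s₁, s₂]) *ᵥ v = 0} = 2 →
    (sigma2'CfgEven ![7, r₁.val, r₂.val] (betaOf ![7, r₁.val, r₂.val] ![s₀, s₁, s₂]) = 0 ↔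
      silentEvenCfg ![7, r₁.val, r₂.val] (betaOf ![7, r₁.val, r₂.val] ![s₀, s₁, s₂]) = true) := by
  decide

/-- The residue product `r₀r₁r₂ ≡ 3 (mod 4)` forces `r₀` odd and `r₀r₁r₂ ≡ 3, 7 (mod 8)`.
[cite: IrelandRosen1990, Ch. 5 §1] -/
theorem odd_and_mod_eight_of_mod_four_three {a b c : ℕ} (h : (a * b * c) % 4 = 3) :
    a % 2 = 1 ∧ ((a * b * c) % 8 = 3 ∨ (a * b * c) % 8 = 7) := by
  refine ⟨?_, by omega⟩
  have h2 : (a * b * c) % 2 = 1 := by omega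
  have hodd := Nat.odd_iff.mpr h2
  rw [Nat.odd_mul, Nat.odd_mul] at hodd
  exact Nat.odd_iff.mp hodd.1.1

/-- **THE EVEN `ω(m) = 3` CENSUS.** On every ordered configuration of three odd residues with
`r₀r₁r₂ ≡ 3 (mod 4)` (`n = 2p₀p₁p₂ ≡ 6 (mod 8)`; `256` configurations, Monsky kernel `2` on `194`): GIVEN
Monsky kernel `2` (`s(n) = 1`), TYZ's `Σ₂′(n)` is EVEN — DOOR B6 / Thm 1.2 is SILENT — iff the
configuration is one of the THIRTEEN REGISTERED SILENT KEYS up to relabelling (`66` ordered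
configurations), and ODD (LOUD: the door speaks) on the other `128`. Assembled from the eight blocks.
[cite: TianYuanZhang2017, Thm. 1.2 (n ≡ 6 (mod 8))] [cite: HeathBrown1994SelmerCongruentII, Appendix (Monsky), typescript p. 41 L20–L36] -/
theorem evenSigmaCfg_iff_of_card_ker : ∀ (r₀ r₁ r₂ : Fin 8) (s₀ s₁ s₂ : ZMod 2),
    (r₀.val * r₁.val * r₂.val) % 4 = 3 →
    Fintype.card {v : Fin 3 ⊕ Fin 3 → ZMod 2 //
      monskyCfgEven ![r₀.val, r₁.val, r₂.val] (betaOf ![r₀.val, r₁.val, r₂.val] ![s₀, s₁, s₂])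
        *ᵥ v = 0} = 2 →
    (sigma2'CfgEven ![r₀.val, r₁.val, r₂.val] (betaOf ![r₀.val, r₁.val, r₂.val] ![s₀, s₁, s₂]) = 0 ↔
      silentEvenCfg ![r₀.val, r₁.val, r₂.val]
        (betaOf ![r₀.val, r₁.val, r₂.val] ![s₀, s₁, s₂]) = true) := by
  intro r₀ r₁ r₂ s₀ s₁ s₂ h4
  obtain ⟨hodd, h8⟩ := odd_and_mod_eight_of_mod_four_three h4
  fin_cases r₀
  · exact absurd hodd (by decide)
  · rcases h8 with h8 | h8
    · exact evenSigmaCfg_iff_of_card_ker_one_three r₁ r₂ s₀ s₁ s₂ h8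
    · exact evenSigmaCfg_iff_of_card_ker_one_seven r₁ r₂ s₀ s₁ s₂ h8
  · exact absurd hodd (by decide)
  · rcases h8 with h8 | h8
    · exact evenSigmaCfg_iff_of_card_ker_three_three r₁ r₂ s₀ s₁ s₂ h8
    · exact evenSigmaCfg_iff_of_card_ker_three_seven r₁ r₂ s₀ s₁ s₂ h8
  · exact absurd hodd (by decide)
  · rcases h8 with h8 | h8
    · exact evenSigmaCfg_iff_of_card_ker_five_three r₁ r₂ s₀ s₁ s₂ h8
    · exact evenSigmaCfg_iff_of_card_ker_five_seven r₁ r₂ s₀ s₁ s₂ h8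
  · exact absurd hodd (by decide)
  · rcases h8 with h8 | h8
    · exact evenSigmaCfg_iff_of_card_ker_seven_three r₁ r₂ s₀ s₁ s₂ h8
    · exact evenSigmaCfg_iff_of_card_ker_seven_seven r₁ r₂ s₀ s₁ s₂ h8

/-- `r₀ ≡ 1 (mod 8)`: a silent key has Monsky kernel `2` (`decide`; the product hypothesis prunes the
enumeration). [cite: HeathBrown1994SelmerCongruentII, Appendix (Monsky), typescript p. 41 L20–L36] -/
theorem card_ker_of_silentEvenCfg_one : ∀ (r₁ r₂ : Fin 8) (s₀ s₁ s₂ : ZMod 2),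
    (1 * r₁.val * r₂.val) % 4 = 3 →
    silentEvenCfg ![1, r₁.val, r₂.val] (betaOf ![1, r₁.val, r₂.val] ![s₀, s₁, s₂]) = true →
    Fintype.card {v : Fin 3 ⊕ Fin 3 → ZMod 2 //
      monskyCfgEven ![1, r₁.val, r₂.val] (betaOf ![1, r₁.val, r₂.val] ![s₀, s₁, s₂]) *ᵥ v = 0} = 2 := by
  decide

/-- `r₀ ≡ 3 (mod 8)`: a silent key has Monsky kernel `2` (`decide`; the product hypothesis prunes the
enumeration). [cite: HeathBrown1994SelmerCongruentII, Appendix (Monsky), typescript p. 41 L20–L36] -/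
theorem card_ker_of_silentEvenCfg_three : ∀ (r₁ r₂ : Fin 8) (s₀ s₁ s₂ : ZMod 2),
    (3 * r₁.val * r₂.val) % 4 = 3 →
    silentEvenCfg ![3, r₁.val, r₂.val] (betaOf ![3, r₁.val, r₂.val] ![s₀, s₁, s₂]) = true →
    Fintype.card {v : Fin 3 ⊕ Fin 3 → ZMod 2 //
      monskyCfgEven ![3, r₁.val, r₂.val] (betaOf ![3, r₁.val, r₂.val] ![s₀, s₁, s₂]) *ᵥ v = 0} = 2 := by
  decide

/-- `r₀ ≡ 5 (mod 8)`: a silent key has Monsky kernel `2` (`decide`; the product hypothesis prunes the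
enumeration). [cite: HeathBrown1994SelmerCongruentII, Appendix (Monsky), typescript p. 41 L20–L36] -/
theorem card_ker_of_silentEvenCfg_five : ∀ (r₁ r₂ : Fin 8) (s₀ s₁ s₂ : ZMod 2),
    (5 * r₁.val * r₂.val) % 4 = 3 →
    silentEvenCfg ![5, r₁.val, r₂.val] (betaOf ![5, r₁.val, r₂.val] ![s₀, s₁, s₂]) = true →
    Fintype.card {v : Fin 3 ⊕ Fin 3 → ZMod 2 //
      monskyCfgEven ![5, r₁.val, r₂.val] (betaOf ![5, r₁.val, r₂.val] ![s₀, s₁, s₂]) *ᵥ v = 0} = 2 := by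
  decide

/-- `r₀ ≡ 7 (mod 8)`: a silent key has Monsky kernel `2` (`decide`; the product hypothesis prunes the
enumeration). [cite: HeathBrown1994SelmerCongruentII, Appendix (Monsky), typescript p. 41 L20–L36] -/
theorem card_ker_of_silentEvenCfg_seven : ∀ (r₁ r₂ : Fin 8) (s₀ s₁ s₂ : ZMod 2),
    (7 * r₁.val * r₂.val) % 4 = 3 →
    silentEvenCfg ![7, r₁.val, r₂.val] (betaOf ![7, r₁.val, r₂.val] ![s₀, s₁, s₂]) = true →
    Fintype.card {v : Fin 3 ⊕ Fin 3 → ZMod 2 //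
      monskyCfgEven ![7, r₁.val, r₂.val] (betaOf ![7, r₁.val, r₂.val] ![s₀, s₁, s₂]) *ᵥ v = 0} = 2 := by
  decide

/-- **Every registered silent key has Monsky kernel `2`** (`s(n) = 1` on all `66` ordered silent
configurations). Assembled from the four blocks above (even `r₀` contradicts `r₀r₁r₂ ≡ 3 (mod 4)`).
[cite: HeathBrown1994SelmerCongruentII, Appendix (Monsky), typescript p. 41 L20–L36] -/
theorem card_ker_of_silentEvenCfg : ∀ (r₀ r₁ r₂ : Fin 8) (s₀ s₁ s₂ : ZMod 2),
    (r₀.val * r₁.val * r₂.val) % 4 = 3 →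
    silentEvenCfg ![r₀.val, r₁.val, r₂.val] (betaOf ![r₀.val, r₁.val, r₂.val] ![s₀, s₁, s₂]) = true →
    Fintype.card {v : Fin 3 ⊕ Fin 3 → ZMod 2 //
      monskyCfgEven ![r₀.val, r₁.val, r₂.val] (betaOf ![r₀.val, r₁.val, r₂.val] ![s₀, s₁, s₂])
        *ᵥ v = 0} = 2 := by
  intro r₀ r₁ r₂ s₀ s₁ s₂ h4
  have hodd := (odd_and_mod_eight_of_mod_four_three h4).1
  fin_cases r₀
  · exact absurd hodd (by decide)
  · exact card_ker_of_silentEvenCfg_one r₁ r₂ s₀ s₁ s₂ h4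
  · exact absurd hodd (by decide)
  · exact card_ker_of_silentEvenCfg_three r₁ r₂ s₀ s₁ s₂ h4
  · exact absurd hodd (by decide)
  · exact card_ker_of_silentEvenCfg_five r₁ r₂ s₀ s₁ s₂ h4
  · exact absurd hodd (by decide)
  · exact card_ker_of_silentEvenCfg_seven r₁ r₂ s₀ s₁ s₂ h4

/-- **Corollary (the LOUD half): kernel `2` and NOT a silent key ⟹ `Σ₂′ ≡ 1`** — DOOR B6's genus
input holds on the `128` loud configurations. [cite: TianYuanZhang2017, Thm. 1.2 (n ≡ 6 (mod 8))] -/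
theorem evenSigmaCfg_eq_one_of_card_ker_of_not_silent (r₀ r₁ r₂ : Fin 8) (s₀ s₁ s₂ : ZMod 2)
    (h4 : (r₀.val * r₁.val * r₂.val) % 4 = 3)
    (hker : Fintype.card {v : Fin 3 ⊕ Fin 3 → ZMod 2 //
      monskyCfgEven ![r₀.val, r₁.val, r₂.val] (betaOf ![r₀.val, r₁.val, r₂.val] ![s₀, s₁, s₂])
        *ᵥ v = 0} = 2)
    (hns : silentEvenCfg ![r₀.val, r₁.val, r₂.val]
      (betaOf ![r₀.val, r₁.val, r₂.val] ![s₀, s₁, s₂]) = false) :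
    sigma2'CfgEven ![r₀.val, r₁.val, r₂.val] (betaOf ![r₀.val, r₁.val, r₂.val] ![s₀, s₁, s₂]) = 1 := by
  have h := evenSigmaCfg_iff_of_card_ker r₀ r₁ r₂ s₀ s₁ s₂ h4 hker
  rw [hns] at h
  rcases (by decide : ∀ z : ZMod 2, z = 0 ∨ z = 1)
    (sigma2'CfgEven ![r₀.val, r₁.val, r₂.val] (betaOf ![r₀.val, r₁.val, r₂.val] ![s₀, s₁, s₂])) with hz | hz
  · exact absurd (h.mp hz) (by decide)
  · exact hz

/-- **Corollary (the SILENT half): a silent key ⟹ kernel `2` and `Σ₂′ ≡ 0`** — on the thirteen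
registered families `s(n) = 1` holds and Tian–Yuan–Zhang's Thm 1.2 / DOOR B6 says nothing.
[cite: TianYuanZhang2017, Thm. 1.2 (n ≡ 6 (mod 8))] [cite: HeathBrown1994SelmerCongruentII, Appendix (Monsky), typescript p. 41 L20–L36] -/
theorem card_ker_and_evenSigmaCfg_of_silent (r₀ r₁ r₂ : Fin 8) (s₀ s₁ s₂ : ZMod 2)
    (h4 : (r₀.val * r₁.val * r₂.val) % 4 = 3)
    (hs : silentEvenCfg ![r₀.val, r₁.val, r₂.val]
      (betaOf ![r₀.val, r₁.val, r₂.val] ![s₀, s₁, s₂]) = true) :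
    Fintype.card {v : Fin 3 ⊕ Fin 3 → ZMod 2 //
      monskyCfgEven ![r₀.val, r₁.val, r₂.val] (betaOf ![r₀.val, r₁.val, r₂.val] ![s₀, s₁, s₂])
        *ᵥ v = 0} = 2 ∧
    sigma2'CfgEven ![r₀.val, r₁.val, r₂.val] (betaOf ![r₀.val, r₁.val, r₂.val] ![s₀, s₁, s₂]) = 0 := by
  have hker := card_ker_of_silentEvenCfg r₀ r₁ r₂ s₀ s₁ s₂ h4 hs
  exact ⟨hker, (evenSigmaCfg_iff_of_card_ker r₀ r₁ r₂ s₀ s₁ s₂ h4 hker).mpr hs⟩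

end Census

end Summit.BirchSwinnertonDyer.Rank1Residual.P2
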